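import Summits.Ventures.CertifiedManyBodySolver.Downfold.EmeryBoxesHg1201OneBandImage
import Summits.Ventures.CertifiedManyBodySolver.Downfold.EmeryBoxesHg1201SOLTrueCornerBandNH1125NH116
import Summits.Ventures.CertifiedManyBodySolver.Downfold.EmeryOneBandImageBand
import Summits.Ventures.CertifiedManyBodySolver.Downfold.EmeryScaleBoxHg1201NH1125Pts
import Summits.Ventures.CertifiedManyBodySolver.Downfold.EmeryVanHoveHg1201
import HarnessLib

/-!
# THE ONE-BAND IMAGE OF HgBa₂CuO₄ (box #19) OVER A DOPING BAND — `emeryBoxHg1201 ∩ {Δ_pd ∈ [2.17, 2.5]} (solver-level Δ tag)` ([2.17, 2.5] × [1.12, 1.32] × [0.64, 0.85] × [0.161, 0.208] eV), x ∈ [0.125, 0.16] (ν ∈ [21/50, 7/16]; columns M19 (n_H 1.125) … M19 (n_H 1.16)): ONE typed statement «∀ member θ ∀ filling ν ∈ [ν₁, ν₂]»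
# (INFL-3to1-B §B.98 THE DOPING CONTINUUM; kernel `EmeryOneBandImageBand`; router/ONE-BAND-IMAGE-BANDS.tsv)

Venture CertifiedManyBodySolver, cell `pub/hubbard-downfold` (stage S1), seat hubbard-downfold-mod-4 (technique B, g43); namespace `Summit.Ventures.CertifiedManyBodySolver.Downfold.Emery`.
Everything PROVED (0 sorry; no new certificate). DEVICE: at fixed θ every image coordinate is monotone in the Fermi energy (t_node ↓, w_node ↓, w_face ↓, w_axis ↓ in ε; corpus levers) and
ε_F(θ; ν) is non-decreasing in ν, so each coordinate at ν ∈ [ν₁, ν₂] lies between its values at the END fillings, which the landed column capstones `hg1201SOLBox_oneBandImage_nH1125` (n_H = 1.125 (x = 0.125)) and `hg1201SOLBox_oneBandImage_nH116` (n_H = 1.16 (x = 0.16)) window for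
every member; the box-wide Fermi-energy ceiling E_h = 4089/2000 (`scalePt_Hg1201NH1125_TP_br`) carries the regime margins and the one box-wide upper-face-edge inequality `0 ≤ faceU(θ; E_h)` (four corners at the lowest t_pd, t_pp); t′/t by the true-corner band device `EmeryBoxesHg1201SOLTrueCornerBandNH1125NH116`.
WHAT THIS IS NOT: a statement about HgBa₂CuO₄ (box #19) — the typed box and its tags are SCREENING-GRADE; `U = 0` one-body kinematics of the σ model (rigid band); no U number; not a phase word.

| box | doping band | t (eV) | t′/t | w_node | 4th / 5th coordinate |
|---|---|---|---|---|---|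
| emeryBoxHg1201 ∩ {Δ_pd ∈ [2.17, 2.5]} (solver-level Δ tag) | x ∈ [0.125, 0.16] (ν ∈ [21/50, 7/16]; columns M19 (n_H 1.125) … M19 (n_H 1.16)) | [0.4049, 0.6323] | [-0.3383, -0.2640] | [0.6009, 0.7306] | HOLE-LIKE topology at every filling and zone-face antinodal weight `w_face ∈ [0.6753, 0.7843]` |

Sources: three-band model [HybertsenSchluterChristensen1989, Eq. (1)]; [AndersenEtAl1995, §6]; [folklore] algebra.
-/

noncomputable section

namespace Summit.Ventures.CertifiedManyBodySolver.Downfold.Emery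

open Real Set

/-- **THE ONE-BAND IMAGE OF `emeryBoxHg1201` — emeryBoxHg1201 ∩ {Δ_pd ∈ [2.17, 2.5]} (solver-level Δ tag) — OVER THE DOPING BAND x ∈ [0.125, 0.16] (ν ∈ [21/50, 7/16]; columns M19 (n_H 1.125) … M19 (n_H 1.16))**: for EVERY member θ AND EVERY filling ν of the band: `t ∈ [0.4049, 0.6323]` eV, `t′/t ∈ [-0.3383, -0.2640]`, `w_node ∈ [0.6009, 0.7306]`, HOLE-LIKE topology at every filling and zone-face antinodal weight `w_face ∈ [0.6753, 0.7843]`. Pure composition: kernel `EmeryOneBandImageBand` (filling levers) + the two END-column capstones `hg1201SOLBox_oneBandImage_nH1125` / `hg1201SOLBox_oneBandImage_nH116` + the t′/t true-corner band `hg1201SOLBox_fsRatio_true_band_nH1125_nH116`. [folklore] -/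
theorem hg1201SOLBox_oneBandImage_band_nH1125_nH116 {Δ a b c ν : ℝ} (hΔ : Δ ∈ Icc ((217 : ℝ) / 100) ((5 : ℝ) / 2)) (ha : a ∈ Icc ((28 : ℝ) / 25) ((33 : ℝ) / 25)) (hb : b ∈ Icc ((16 : ℝ) / 25) ((17 : ℝ) / 20)) (hc : c ∈ Icc ((161 : ℝ) / 1000) ((26 : ℝ) / 125)) (hν : ν ∈ Icc ((21 : ℝ) / 50) ((7 : ℝ) / 16)) :
    scaleT Δ a b c (xNode Δ a b c (fermiEnergyOf Δ a b c ν)) (xNode Δ a b c (fermiEnergyOf Δ a b c ν)) (fermiEnergyOf Δ a b c ν) ∈ Icc (4049/10000 : ℝ) (6323/10000 : ℝ) ∧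
      fsRatio Δ a b c (fermiEnergyOf Δ a b c ν) ∈ Icc ((-3383 : ℝ) / 10000) ((-33 : ℝ) / 125) ∧
      dWeightNode Δ a b c (fermiEnergyOf Δ a b c ν) ∈ Icc ((6009 : ℝ) / 10000) ((3653 : ℝ) / 5000) ∧
      (0 < faceG Δ a c (fermiEnergyOf Δ a b c ν) ∧ 1 < xAxis Δ a c (fermiEnergyOf Δ a b c ν)) ∧
        dWeightFace Δ a b c (fermiEnergyOf Δ a b c ν) ∈ Icc ((6753 : ℝ) / 10000) ((7843 : ℝ) / 10000) := by
  have hΔ0 : 0 < Δ := lt_of_lt_of_le (by norm_num) hΔ.1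
  have ha0 : 0 < a := lt_of_lt_of_le (by norm_num) ha.1
  have hc0 : 0 ≤ c := le_trans (by norm_num) hc.1
  have hcb : c ≤ b := hc.2.trans (le_trans (by norm_num) hb.1)
  have hb0 : 0 ≤ b := hc0.trans hcb
  have hΔw : Δ ∈ Icc ((7 : ℝ) / 5) ((5 : ℝ) / 2) := ⟨le_trans (by norm_num) hΔ.1, le_trans hΔ.2 (by norm_num)⟩
  -- the two END columns (landed capstones)
  have h2 := hg1201SOLBox_oneBandImage_nH1125 hΔ ha hb hc
  have h1 := hg1201SOLBox_oneBandImage_nH116 hΔ ha hb hc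
  -- the box-wide Fermi-energy ceiling E_h = 4089/2000 (top corner (Δ₁, a₂, b₂, c₁) of the whole box at ν = 7/16, `scalePt_Hg1201NH1125_TP_br`)
  have hT := (fermiEnergyOf_of_pointBracketCheck scalePt_Hg1201NH1125_TP_br (by norm_num) (by norm_num) (by norm_num) (ν := (7/16 : ℝ)) (by push_cast; exact ⟨le_rfl, le_rfl⟩)).2
  push_cast at hT
  have hbox := fermiEnergyOf_mem_Icc_of_mem_box' (ν := ((7 : ℝ) / 16)) (by norm_num) (by norm_num) (by norm_num) (by norm_num) hΔw ha hb hc (by norm_num) (by norm_num)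
  have htop : ((7 : ℝ) / 16) = (7/16 : ℝ) := by norm_num
  have hEh0 : fermiEnergyOf Δ a b c ((7 : ℝ) / 16) ≤ ((4089 : ℝ) / 2000) := by
    refine hbox.2.trans ?_
    rw [htop]; exact hT.2
  have hEh : fermiEnergyOf Δ a b c ((7 : ℝ) / 16) ≤ ((4089 : ℝ) / 2000) :=
    fermiEnergyOf_le_of_band (ν₂ := ((7 : ℝ) / 16)) hΔ0 ha0.ne' hc0 hb0 (by norm_num) (by norm_num) (by norm_num) hEh0
  have ha2 : ((28 : ℝ) / 25) ^ 2 ≤ a ^ 2 := pow_le_pow_left₀ (by norm_num) ha.1 2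
  have hm : c * (((4089 : ℝ) / 2000)) < a ^ 2 := by nlinarith [hc.2]
  have hq : b * Δ < 4 * a ^ 2 := by nlinarith [mul_le_mul hb.2 hΔw.2 hΔ0.le (by norm_num : (0 : ℝ) ≤ ((17 : ℝ) / 20))]
  -- the upper face edge at E_h over the box from four corners at the lowest t_pd / t_pp
  have hU : 0 ≤ faceU Δ a b c ((4089 : ℝ) / 2000) :=
    faceU_nonneg_on_box4 (Δ₁ := ((217 : ℝ) / 100)) (Δ₂ := ((5 : ℝ) / 2)) (a₁ := ((28 : ℝ) / 25)) (b₁ := ((16 : ℝ) / 25)) (c₁ := ((161 : ℝ) / 1000)) (c₂ := ((26 : ℝ) / 125))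
      (by norm_num) (by norm_num) (by norm_num) (by norm_num) (by norm_num) hΔ ha.1 hb.1 hc
      (by norm_num [faceU_eq]) (by norm_num [faceU_eq]) (by norm_num [faceU_eq]) (by norm_num [faceU_eq])
  -- hole-likeness floor (x_VH ≥ 0.2150 on the box, `hg1201Box_xVH`)
  have hΔx : Δ ∈ Set.Icc (7 / 5 : ℝ) (5 / 2 : ℝ) := ⟨le_trans (by norm_num) hΔ.1, le_trans hΔ.2 (by norm_num)⟩
  have hax : a ∈ Set.Icc (28 / 25 : ℝ) (33 / 25 : ℝ) := ⟨le_trans (by norm_num) ha.1, le_trans ha.2 (by norm_num)⟩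
  have hbx : b ∈ Set.Icc (16 / 25 : ℝ) (17 / 20 : ℝ) := ⟨le_trans (by norm_num) hb.1, le_trans hb.2 (by norm_num)⟩
  have hcx : c ∈ Set.Icc (111 / 1000 : ℝ) (26 / 125 : ℝ) := ⟨le_trans (by norm_num) hc.1, le_trans hc.2 (by norm_num)⟩
  have hx : (15851 / 73728 : ℝ) ≤ xVH Δ a b c := (hg1201Box_xVH hΔx hax hbx hcx).2.2.2.1
  refine ⟨?_, hg1201SOLBox_fsRatio_true_band_nH1125_nH116 hΔ ha hb hc hν, ?_, ?_, ?_⟩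
  · exact scaleT_node_fermiEnergyOf_mem_Icc_of_band hΔ0 ha0.ne' hc0 hcb (by norm_num) hν (by norm_num) hEh hm hq h2.1.1 h1.1.2
  · exact dWeightNode_fermiEnergyOf_mem_Icc_of_band hΔ0 ha0.ne' hc0 hcb (by norm_num) hν (by norm_num) h2.2.2.1.1 h1.2.2.1.2
  · exact holeLike_of_band (X := (15851 / 73728 : ℝ)) hΔ0 ha0 hc0 hb0 (by norm_num) hν (by norm_num) hx (by norm_num) hEh hm
  · exact dWeightFace_fermiEnergyOf_mem_Icc_of_band (X := (15851 / 73728 : ℝ)) hΔ0 ha0 hc0 hcb (by norm_num) hν (by norm_num) hx (by norm_num) hEh hm hU h2.2.2.2.1 h1.2.2.2.2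

end Summit.Ventures.CertifiedManyBodySolver.Downfold.Emery
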